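import Literature.NumberTheory.Transcendental.GammaKummerLevels
import Literature.NumberTheory.Transcendental.GammaIsoAlgebraicStep
import HarnessLib

/-!
# Relative normalisation of a good basis (bounded denominators over the base Γ-field)

Toolkit for Bays–Kirby 2018, Prop. 11.2 (`Literature.NumberTheory.Transcendental.BaysKirby2018_prop_11_2`; M. Bays, J. Kirby,
*Pseudo-exponential maps, variants, and quasiminimality*, Algebra & Number Theory 12 (2018),
§3.3, Prop. 3.24 (bounded denominators ⇒ good bases exist), proof of Lemma 8.3).

Let `E = ⟨K c⟩ = K₀(allGens c)` be the full Γ-field of a tuple `c` over the Γ-closed `K`, `b` a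
tuple with `exp` of every non-zero `ℤ`-combination of `b` outside `E`, and suppose `E` is
relatively algebraically closed in `Ω = E(b, exp b) = K₀(allGens c, b, exp b)`. The *relative
Kummer lattice* `Φ = {q ∈ ℚⁿ : exp ⟪q, b⟫ ∈ Ω}` contains `ℤⁿ` and, by the bounded-denominators
theorem over the finitely generated regular extension `Ω/E`
(`Literature.FieldTheory.Kummer.RadicalDenominators.exists_denominator_bound`, B–K Prop. 3.24),
lies in `(1/m₀)ℤⁿ`; a `ℤ`-basis of `Φ` yields a new `ℚ`-basis `b̃` of `ℚb` with `exp b̃ⱼ ∈ Ω`,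
the same field `Ω`, and `exp b̃₁, …, exp b̃ₙ` independent modulo `m`-th powers in `Ω` for every
`m ≥ 1` (`GammaField.exists_relative_normalised_basis`) — the hypothesis of
`GammaField.IsGammaIso.append_of_ringHom_adjoin` (`GammaRelativeKummer.lean`).

## References

* M. Bays, J. Kirby, *Pseudo-exponential maps, variants, and quasiminimality*, Algebra & Number
  Theory 12 (2018) 493–549: Def. 3.19, Prop. 3.22, Prop. 3.24, Lemma 8.3 (proof).
-/

noncomputable section

open Set

namespace Literature.NumberTheory.Transcendental

namespace GammaField

open Literature.ModelTheory.ExponentialFields.ExponentialRing Literature.FieldTheory.Kummer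

variable {F : Type*} [Field F] [CharZero F] [Literature.ModelTheory.ExponentialFields.ExponentialRing F]
variable {K : Submodule ℚ F} {N n : ℕ}

/-- `exp (Σ vⱼ bⱼ) = ∏ (exp bⱼ)^{vⱼ}` for an integer vector. [folklore] -/
theorem exp_sum_intCast_smul (b : Fin n → F) (v : Fin n → ℤ) :
    exp (∑ j, (v j : ℚ) • b j) = ∏ j, exp (b j) ^ v j :=
  exp_pairing_intCast b v

omit [Literature.ModelTheory.ExponentialFields.ExponentialRing F] in
/-- `ℚ`-combinations of elements of an intermediate field lie in it. [folklore] -/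
theorem sum_rat_smul_mem_intermediateField {k : Type*} [Field k] [Algebra k F]
    (Ω : IntermediateField k F) {b : Fin n → F} (hb : ∀ j, b j ∈ Ω) (q : Fin n → ℚ) :
    ∑ j, q j • b j ∈ Ω := by
  refine sum_mem fun j _ => ?_
  rw [Rat.smul_def]
  exact mul_mem (SubfieldClass.ratCast_mem Ω (q j)) (hb j)

/-- `K₀(allGens c, b, exp b)` is finitely generated over `⟨K c⟩ = K₀(allGens c)` (by `b, exp b`).
[folklore] -/
theorem adjoin_gammaPt_fg (c : Fin N → F) (b : Fin n → F) :
    ∃ s : Finset (IntermediateField.adjoin (IntermediateField.adjoin (fieldOf K) (allGens c)) (range (gammaPt b))),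
      IntermediateField.adjoin (IntermediateField.adjoin (fieldOf K) (allGens c))
        (s : Set (IntermediateField.adjoin (IntermediateField.adjoin (fieldOf K) (allGens c)) (range (gammaPt b)))) =
        ⊤ := by
  classical
  let g : Fin n ⊕ Fin n → IntermediateField.adjoin (IntermediateField.adjoin (fieldOf K) (allGens c))
      (range (gammaPt b)) := fun r => ⟨gammaPt b r, IntermediateField.subset_adjoin _ _ ⟨r, rfl⟩⟩
  refine ⟨Finset.univ.image g, ?_⟩
  apply IntermediateField.lift_injective
  rw [IntermediateField.lift_top]
  have : Subtype.val '' ((Finset.univ.image g : Finset (IntermediateField.adjoin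
      (IntermediateField.adjoin (fieldOf K) (allGens c)) (range (gammaPt b)))) : Set (IntermediateField.adjoin
      (IntermediateField.adjoin (fieldOf K) (allGens c)) (range (gammaPt b)))) = range (gammaPt b) := by
    ext z
    simp only [Finset.coe_image, Finset.coe_univ, image_univ, mem_image, mem_range]
    constructor
    · rintro ⟨_, ⟨r, rfl⟩, rfl⟩; exact ⟨r, rfl⟩
    · rintro ⟨r, rfl⟩; exact ⟨g r, ⟨r, rfl⟩, rfl⟩
  rw [IntermediateField.lift_adjoin, this]

/-- **Relative normalisation of a good basis** (Bays–Kirby 2018, Prop. 3.24 / Def. 3.19 relative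
to the base Γ-field). Let `K` be Γ-closed in the algebraically closed `F`, `E = ⟨K c⟩`, and `b` a
tuple such that `exp` of a non-zero `ℤ`-combination of `b` is never in `E` and `E` is relatively
algebraically closed in `Ω = K₀(allGens c, b, exp b)`. Then there is `b̃` with `ℚb̃ = ℚb`
(each `bᵢ` an *integer* combination of `b̃`), `exp b̃ⱼ ∈ Ω`, the same field
`K₀(allGens c, b̃, exp b̃) = Ω`, and `exp b̃₁, …, exp b̃ₙ` independent modulo `m`-th powers in `Ω`
for every `m ≥ 1`. [cite: BaysKirby2018ANT, Prop. 3.24, Prop. 3.22 (proof), Lemma 8.3 (proof)] -/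
theorem exists_relative_normalised_basis [IsAlgClosed F] (hK : IsGammaClosed K) (c : Fin N → F)
    {b : Fin n → F}
    (hmul : ∀ w : Fin n → ℤ, exp (∑ j, (w j : ℚ) • b j) ∈
      IntermediateField.adjoin (fieldOf K) (allGens c) → w = 0)
    (hrac : ∀ z ∈ IntermediateField.adjoin (fieldOf K) (allGens c ∪ range (gammaPt b)),
      IsAlgebraic (IntermediateField.adjoin (fieldOf K) (allGens c)) z →
        z ∈ IntermediateField.adjoin (fieldOf K) (allGens c)) :
    ∃ bt : Fin n → F,
      (∀ j, bt j ∈ Submodule.span ℚ (range b)) ∧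
      (∀ i, ∃ z : Fin n → ℤ, b i = ∑ j, (z j : ℚ) • bt j) ∧
      IntermediateField.adjoin (fieldOf K) (allGens c ∪ range (gammaPt bt)) =
        IntermediateField.adjoin (fieldOf K) (allGens c ∪ range (gammaPt b)) ∧
      ∀ m, 0 < m → IndepModPowers m (fun j =>
        (⟨exp (bt j), IntermediateField.subset_adjoin _ _ (Or.inr ⟨Sum.inr j, rfl⟩)⟩ :
          IntermediateField.adjoin (fieldOf K) (allGens c ∪ range (gammaPt bt)))) := by
  classical
  -- the nested presentation `Ω₂ = E(b, exp b)` of `Ω`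
  have hΩ₂ : (IntermediateField.adjoin (IntermediateField.adjoin (fieldOf K) (allGens c))
      (range (gammaPt b))).restrictScalars (fieldOf K) =
      IntermediateField.adjoin (fieldOf K) (allGens c ∪ range (gammaPt b)) :=
    IntermediateField.adjoin_adjoin_left _ _ _
  have hmemΩ₂ : ∀ z : F, z ∈ IntermediateField.adjoin (IntermediateField.adjoin (fieldOf K) (allGens c))
      (range (gammaPt b)) ↔ z ∈ IntermediateField.adjoin (fieldOf K) (allGens c ∪ range (gammaPt b)) := by
    intro z
    rw [← IntermediateField.mem_restrictScalars (fieldOf K), hΩ₂]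
  -- Step 1: bounded denominators over `E`
  let a : Fin n → (IntermediateField.adjoin (IntermediateField.adjoin (fieldOf K) (allGens c))
      (range (gammaPt b)))ˣ := fun j =>
    Units.mk0 ⟨exp (b j), IntermediateField.subset_adjoin _ _ ⟨Sum.inr j, rfl⟩⟩
      (fun h0 => exp_ne_zero (b j) (congrArg Subtype.val h0))
  have ha : ∀ j, (((a j : (IntermediateField.adjoin (IntermediateField.adjoin (fieldOf K) (allGens c))
      (range (gammaPt b)))ˣ) : IntermediateField.adjoin (IntermediateField.adjoin (fieldOf K) (allGens c))
      (range (gammaPt b))) : F) = exp (b j) := fun _ => rfl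
  have hcoe : ∀ w : Fin n → ℤ, (((∏ j, a j ^ w j : (IntermediateField.adjoin
      (IntermediateField.adjoin (fieldOf K) (allGens c)) (range (gammaPt b)))ˣ) :
      IntermediateField.adjoin (IntermediateField.adjoin (fieldOf K) (allGens c)) (range (gammaPt b))) : F) =
      ∏ j, exp (b j) ^ w j := by
    intro w
    rw [Units.coe_prod]
    rw [show (((∏ i, (↑(a i ^ w i) : IntermediateField.adjoin (IntermediateField.adjoin (fieldOf K) (allGens c))
        (range (gammaPt b)))) : IntermediateField.adjoin (IntermediateField.adjoin (fieldOf K) (allGens c))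
        (range (gammaPt b))) : F) = ∏ i, ((↑(a i ^ w i) : IntermediateField.adjoin
        (IntermediateField.adjoin (fieldOf K) (allGens c)) (range (gammaPt b))) : F) from
      map_prod (algebraMap (IntermediateField.adjoin (IntermediateField.adjoin (fieldOf K) (allGens c))
        (range (gammaPt b))) F) _ _]
    refine Finset.prod_congr rfl fun j _ => ?_
    rw [← ha j, Units.val_zpow_eq_zpow_val]
    exact map_zpow₀ (algebraMap (IntermediateField.adjoin (IntermediateField.adjoin (fieldOf K) (allGens c))
      (range (gammaPt b))) F) _ _
  have hind : ∀ w : Fin n → ℤ, ((∏ j, a j ^ w j : (IntermediateField.adjoin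
      (IntermediateField.adjoin (fieldOf K) (allGens c)) (range (gammaPt b)))ˣ) :
      IntermediateField.adjoin (IntermediateField.adjoin (fieldOf K) (allGens c)) (range (gammaPt b))) ∈
      range (algebraMap (IntermediateField.adjoin (fieldOf K) (allGens c)) _) → w = 0 := by
    rintro w ⟨e, he⟩
    apply hmul w
    rw [exp_sum_intCast_smul, ← hcoe w, ← he, IntermediateField.coe_algebraMap_apply,
      IntermediateField.algebraMap_apply]
    exact e.2
  have hfg := adjoin_gammaPt_fg (K := K) c b
  have hKrac : ∀ z : IntermediateField.adjoin (IntermediateField.adjoin (fieldOf K) (allGens c))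
      (range (gammaPt b)), IsAlgebraic (IntermediateField.adjoin (fieldOf K) (allGens c)) z →
      z ∈ range (algebraMap (IntermediateField.adjoin (fieldOf K) (allGens c)) _) := by
    intro z hz
    have hzF : IsAlgebraic (IntermediateField.adjoin (fieldOf K) (allGens c)) (z : F) := hz.algebraMap
    have hmem := hrac (z : F) ((hmemΩ₂ z).1 z.2) hzF
    refine ⟨⟨z, hmem⟩, Subtype.ext ?_⟩
    rw [IntermediateField.coe_algebraMap_apply, IntermediateField.algebraMap_apply]
  obtain ⟨m₀, hm₀, hden⟩ := RadicalDenominators.exists_denominator_bound hfg hKrac a hind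
  -- Step 2: the relative Kummer lattice
  let Φ : Submodule ℤ (Fin n → ℚ) :=
    { carrier := {q | exp (pairing b q) ∈ IntermediateField.adjoin (fieldOf K) (allGens c ∪ range (gammaPt b))}
      add_mem' := fun {q q'} hq hq' => by
        simp only [mem_setOf_eq] at hq hq' ⊢
        rw [pairing_add, exp_add]
        exact mul_mem hq hq'
      zero_mem' := by
        simp only [mem_setOf_eq, pairing_zero, exp_zero]
        exact one_mem _
      smul_mem' := fun z q hq => by
        simp only [mem_setOf_eq] at hq ⊢
        rw [pairing_zsmul, exp_zsmul]
        exact zpow_mem hq z }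
  have hΦ : ∀ q, q ∈ Φ ↔ exp (pairing b q) ∈
      IntermediateField.adjoin (fieldOf K) (allGens c ∪ range (gammaPt b)) := fun q => Iff.rfl
  have hstd : ∀ i, (Pi.single i 1 : Fin n → ℚ) ∈ Φ := fun i => by
    rw [hΦ, pairing_single, one_smul]
    exact IntermediateField.subset_adjoin _ _ (Or.inr ⟨Sum.inr i, rfl⟩)
  have hden' : ∀ q ∈ Φ, ∀ i, ∃ z : ℤ, (m₀ : ℚ) * q i = z := by
    intro q hq i
    obtain ⟨D, hD, v, hv⟩ := exists_common_den q
    have hy : exp (pairing b q) ∈ IntermediateField.adjoin (IntermediateField.adjoin (fieldOf K) (allGens c))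
        (range (gammaPt b)) := (hmemΩ₂ _).2 ((hΦ q).1 hq)
    have hy0 : (⟨exp (pairing b q), hy⟩ : IntermediateField.adjoin
        (IntermediateField.adjoin (fieldOf K) (allGens c)) (range (gammaPt b))) ≠ 0 :=
      fun h0 => exp_ne_zero _ (congrArg Subtype.val h0)
    have hpow : (Units.mk0 _ hy0) ^ D = ∏ j, a j ^ v j := by
      apply Units.ext
      apply Subtype.ext
      rw [hcoe v]
      show exp (pairing b q) ^ D = ∏ j, exp (b j) ^ v j
      rw [← exp_pairing_intCast, exp_pairing_pow]
      congr 2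
      funext s
      rw [Pi.smul_apply, smul_eq_mul, hv s]
    have hdvd := hden D v _ hpow i
    obtain ⟨k, hk⟩ := hdvd
    refine ⟨k, ?_⟩
    have hDq : (D : ℚ) ≠ 0 := Nat.cast_ne_zero.2 hD.ne'
    have h1 : (m₀ : ℚ) * q i * D = (k : ℚ) * D := by
      rw [mul_assoc, mul_comm (q i), hv i]
      have : ((m₀ * v i : ℤ) : ℚ) = ((D * k : ℤ) : ℚ) := by rw [hk]
      push_cast at this
      rw [this, mul_comm]
    exact mul_right_cancel₀ hDq h1
  obtain ⟨B⟩ := nonempty_basis_of_lattice Φ hm₀ hstd hden'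
  -- `ℤ`-basis facts
  have hBli : LinearIndependent ℤ fun r => (B r : Fin n → ℚ) :=
    B.linearIndependent.map' Φ.subtype (Submodule.ker_subtype _)
  have hBliQ : LinearIndependent ℚ fun r => (B r : Fin n → ℚ) :=
    (LinearIndependent.iff_fractionRing ℤ ℚ).1 hBli
  have hspan : ∀ q ∈ Φ, ∃ z : Fin n → ℤ, q = ∑ r, z r • (B r : Fin n → ℚ) := by
    intro q hq
    refine ⟨fun r => B.repr ⟨q, hq⟩ r, ?_⟩
    have := congrArg Φ.subtype (B.sum_repr ⟨q, hq⟩)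
    rw [map_sum] at this
    simp only [map_zsmul, Submodule.subtype_apply] at this
    exact this.symm
  -- Step 3: the new tuple `b̃ⱼ = ⟪Bⱼ, b⟫`
  have hbi : ∀ i, ∃ z : Fin n → ℤ, b i = ∑ r, (z r : ℚ) • pairing b (B r : Fin n → ℚ) := by
    intro i
    obtain ⟨z, hz⟩ := hspan _ (hstd i)
    refine ⟨z, ?_⟩
    have := congrArg (pairing b) hz
    rw [pairing_single, one_smul, pairing_sum] at this
    rw [this]
    refine Finset.sum_congr rfl fun r _ => ?_
    rw [pairing_zsmul, Int.cast_smul_eq_zsmul]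
  have hfield : IntermediateField.adjoin (fieldOf K)
      (allGens c ∪ range (gammaPt fun j => pairing b (B j : Fin n → ℚ))) =
      IntermediateField.adjoin (fieldOf K) (allGens c ∪ range (gammaPt b)) := by
    refine le_antisymm (IntermediateField.adjoin_le_iff.2 ?_) (IntermediateField.adjoin_le_iff.2 ?_)
    · rintro z (hz | ⟨r, rfl⟩)
      · exact IntermediateField.subset_adjoin _ _ (Or.inl hz)
      · rcases r with j | j
        · simp only [gammaPt, Sum.elim_inl, pairing]
          exact sum_rat_smul_mem_intermediateField
            (IntermediateField.adjoin (fieldOf K) (allGens c ∪ range (gammaPt b))) (b := b)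
            (fun s => IntermediateField.subset_adjoin _ _ (Or.inr ⟨Sum.inl s, rfl⟩)) _
        · simp only [gammaPt, Sum.elim_inr]
          exact (B j).2
    · rintro z (hz | ⟨r, rfl⟩)
      · exact IntermediateField.subset_adjoin _ _ (Or.inl hz)
      · rcases r with i | i
        · obtain ⟨z, hz⟩ := hbi i
          simp only [gammaPt, Sum.elim_inl]
          rw [hz]
          exact sum_rat_smul_mem_intermediateField
            (IntermediateField.adjoin (fieldOf K) (allGens c ∪ range (gammaPt fun j => pairing b (B j : Fin n → ℚ))))
            (b := fun j => pairing b (B j : Fin n → ℚ))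
            (fun s => IntermediateField.subset_adjoin _ _ (Or.inr ⟨Sum.inl s, rfl⟩)) _
        · obtain ⟨z, hz⟩ := hbi i
          simp only [gammaPt, Sum.elim_inr]
          rw [hz, exp_sum_intCast_smul]
          refine prod_mem fun r _ => zpow_mem ?_ _
          exact IntermediateField.subset_adjoin _ _ (Or.inr ⟨Sum.inr r, rfl⟩)
  refine ⟨fun j => pairing b (B j : Fin n → ℚ), fun j => pairing_mem_span b _, hbi, hfield, ?_⟩
  · -- Kummer independence in `Ω`
    intro m hm v hx r
    obtain ⟨x, hx⟩ := hx
    have hmQ : (m : ℚ) ≠ 0 := Nat.cast_ne_zero.2 hm.ne'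
    -- `(x : F)^m = exp ⟪Σ vⱼ Bⱼ, b⟫`
    set qv : Fin n → ℚ := (m : ℚ)⁻¹ • ∑ j, (v j : ℚ) • (B j : Fin n → ℚ) with hqv
    have hsumv : ∑ j, (v j : ℚ) • pairing b (B j : Fin n → ℚ) =
        pairing b (∑ j, (v j : ℚ) • (B j : Fin n → ℚ)) := by
      rw [pairing_sum]
      refine Finset.sum_congr rfl fun j _ => ?_
      rw [pairing_smul]
    have hxm : (x : F) ^ m = exp (pairing b (∑ j, (v j : ℚ) • (B j : Fin n → ℚ))) := by
      have := congrArg (fun z : IntermediateField.adjoin (fieldOf K)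
        (allGens c ∪ range (gammaPt fun j => pairing b (B j : Fin n → ℚ))) => (z : F)) hx
      simp only at this
      rw [SubmonoidClass.coe_pow] at this
      rw [this]
      rw [show (((∏ j, (⟨exp (pairing b (B j : Fin n → ℚ)), IntermediateField.subset_adjoin _ _
          (Or.inr ⟨Sum.inr j, rfl⟩)⟩ : IntermediateField.adjoin (fieldOf K)
          (allGens c ∪ range (gammaPt fun j => pairing b (B j : Fin n → ℚ)))) ^ v j :
          IntermediateField.adjoin (fieldOf K) (allGens c ∪ range (gammaPt fun j => pairing b (B j : Fin n → ℚ))))) : F)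
          = ∏ j, (((⟨exp (pairing b (B j : Fin n → ℚ)), IntermediateField.subset_adjoin _ _
          (Or.inr ⟨Sum.inr j, rfl⟩)⟩ : IntermediateField.adjoin (fieldOf K)
          (allGens c ∪ range (gammaPt fun j => pairing b (B j : Fin n → ℚ)))) ^ v j :
          IntermediateField.adjoin (fieldOf K) (allGens c ∪ range (gammaPt fun j => pairing b (B j : Fin n → ℚ)))) : F)
          from map_prod (algebraMap (IntermediateField.adjoin (fieldOf K)
            (allGens c ∪ range (gammaPt fun j => pairing b (B j : Fin n → ℚ)))) F) _ _]
      rw [← hsumv, exp_sum_intCast_smul]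
      refine Finset.prod_congr rfl fun j _ => ?_
      exact map_zpow₀ (algebraMap (IntermediateField.adjoin (fieldOf K)
        (allGens c ∪ range (gammaPt fun j => pairing b (B j : Fin n → ℚ)))) F) _ _
    have hL : exp (pairing b qv) ^ m = (x : F) ^ m := by
      rw [hxm, exp_pairing_pow]
      congr 2
      rw [hqv, smul_smul, mul_inv_cancel₀ hmQ, one_smul]
    have hx0 : (x : F) ≠ 0 := by
      intro h0
      have : (x : F) ^ m = 0 := by rw [h0, zero_pow hm.ne']
      rw [hxm] at this
      exact exp_ne_zero _ this
    have hζ : (exp (pairing b qv) / (x : F)) ^ m = 1 := by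
      rw [div_pow, hL, div_self (pow_ne_zero _ hx0)]
    have hζK : exp (pairing b qv) / (x : F) ∈ K := hK.mem_of_pow_eq_one hm hζ
    have hxΩ : (x : F) ∈ IntermediateField.adjoin (fieldOf K) (allGens c ∪ range (gammaPt b)) := by
      rw [← hfield]; exact x.2
    have hqvΦ : qv ∈ Φ := by
      rw [hΦ]
      have : exp (pairing b qv) = (exp (pairing b qv) / (x : F)) * (x : F) := by
        rw [div_mul_cancel₀ _ hx0]
      rw [this]
      refine mul_mem ?_ hxΩ
      exact IntermediateField.algebraMap_mem _ (⟨_, mem_fieldOf_of_mem hζK⟩ : fieldOf K)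
    obtain ⟨z, hz⟩ := hspan qv hqvΦ
    have hcoef : ∀ r, (v r : ℚ) / m = z r := by
      have h0 : ∑ r, ((v r : ℚ) / m - z r) • (B r : Fin n → ℚ) = 0 := by
        simp only [sub_smul, Finset.sum_sub_distrib]
        rw [sub_eq_zero]
        have h1 : ∑ r, ((v r : ℚ) / m) • (B r : Fin n → ℚ) = qv := by
          rw [hqv, Finset.smul_sum]
          refine Finset.sum_congr rfl fun r _ => ?_
          rw [smul_smul, div_eq_inv_mul]
        rw [h1, hz]
        refine Finset.sum_congr rfl fun r _ => ?_
        rw [Int.cast_smul_eq_zsmul]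
      intro r
      have := Fintype.linearIndependent_iff.1 hBliQ _ h0 r
      rwa [sub_eq_zero] at this
    have := hcoef r
    rw [div_eq_iff hmQ] at this
    refine ⟨z r, ?_⟩
    have h' : (v r : ℚ) = ((m : ℤ) * z r : ℤ) := by push_cast; rw [this, mul_comm]
    exact_mod_cast h'

end GammaField

end Literature.NumberTheory.Transcendental
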